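import Summits.FinalStateConjecture.FinalStateConjecture.Theorems.UniformPhotonSphereChannels.Negative.CommutedEnergyBound

/-!
# Crux `UniformPhotonSphereChannels` (K1), negative side — REST-PACKET PINNING

Support file of the standing disprover of item stmt-FinalStateConjecture-10045 (step 3, the heart
of the refutation).  Pinning set-up as in `ApproxConservation`/`CommutedEnergyBound`, plus a `C¹`
cut-off `χ`, `0 ≤ χ ≤ 1`, `|χ'| ≤ Cχ`, vanishing on `[Xl − g/2, ∞)` (so `χ = 0` on the initial
support `[Xl, Xr]`).  Then the weighted energy `F(T) = ∫ χ e(T,·)` — the energy that has LEAKED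
to the left of the initial support — obeys (`pinning_bound`)

`F(T₁) ≤ T₁ [ (D/W_min + Cχ λ) · 2E(0) + (Cχ/(λ W_min)) · (2E₁(0) + 16 T₁² D² E(0)/W_min) ]`

for every `λ > 0`, when `T₁ D ≤ W_min/4`: `F(0) = 0`, `F' = ∫ (χ W_t u² − χ' · 2u_t u_x)`,
`|2 u_t u_x| ≤ λ u_t² + u_x²/λ`, `W_min u_x² ≤ e₁`.  In the refutation `T₁ Cχ` is a fixed
number, `T₁ D/W_min → 0` as the ball recedes (`ρ → ∞`) and `E₁(0)/(W_min E(0)) → 0` as `ℓ → ∞`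
for FIXED data: the leaked energy is an arbitrarily small fraction of `E(0)`. [folklore]
-/

namespace Summit.FinalStateConjecture.FinalStateConjecture.Theorems

open MeasureTheory Set Filter Topology intervalIntegral

noncomputable section

namespace WaveDefect

open WaveEnergy

variable {u W : ℝ × ℝ → ℝ} {Xl Xr : ℝ}

/-- **Rest-packet pinning.** See the module docstring. -/
theorem pinning_bound (hu : ContDiff ℝ 3 u) (hW : ContDiff ℝ 1 W) (hW0 : ∀ z, 0 ≤ W z)
    (hsol : ∀ z : ℝ × ℝ, fderiv ℝ (fderiv ℝ u) z (1, 0) (1, 0)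
      - fderiv ℝ (fderiv ℝ u) z (0, 1) (0, 1) + W z * u z = 0)
    (hzeroL : ∀ z : ℝ × ℝ, z.2 + |z.1| < Xl → u z = 0)
    (hzeroR : ∀ z : ℝ × ℝ, Xr < z.2 - |z.1| → u z = 0)
    (hX : Xl ≤ Xr) {T₁ Wmin D : ℝ} (hT₁ : 0 < T₁) (hWmin : 0 < Wmin) (hD : 0 ≤ D)
    (hWK : ∀ z : ℝ × ℝ, z.1 ∈ Icc 0 T₁ → Xl - z.1 ≤ z.2 → z.2 ≤ Xr + z.1 → Wmin ≤ W z)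
    (hDK : ∀ z : ℝ × ℝ, z.1 ∈ Icc 0 T₁ → Xl - z.1 ≤ z.2 → z.2 ≤ Xr + z.1 → |fderiv ℝ W z (1, 0)| ≤ D)
    (hDXK : ∀ z : ℝ × ℝ, z.1 ∈ Icc 0 T₁ → Xl - z.1 ≤ z.2 → z.2 ≤ Xr + z.1 → |fderiv ℝ W z (0, 1)| ≤ D)
    (hsmall : T₁ * D ≤ Wmin / 4)
    {χ : ℝ → ℝ} (hχ : ContDiff ℝ 1 χ) {Cχ g : ℝ} (hg : 0 < g) (hχ01 : ∀ X, 0 ≤ χ X ∧ χ X ≤ 1)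
    (hχ' : ∀ X, |deriv χ X| ≤ Cχ) (hχ0 : ∀ X, Xl - g / 2 ≤ X → χ X = 0)
    {lam : ℝ} (hlam : 0 < lam)
    {e e₁ : ℝ × ℝ → ℝ}
    (he : ∀ z, e z = (fderiv ℝ u z (1, 0)) ^ 2 + (fderiv ℝ u z (0, 1)) ^ 2 + W z * u z ^ 2)
    (he₁ : ∀ z, e₁ z = (fderiv ℝ (fun w => fderiv ℝ u w (0, 1)) z (1, 0)) ^ 2
      + (fderiv ℝ (fun w => fderiv ℝ u w (0, 1)) z (0, 1)) ^ 2
      + W z * (fderiv ℝ u z (0, 1)) ^ 2) :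
    (∫ X in (Xl - T₁ - 1)..(Xr + T₁ + 1), χ X * e (T₁, X))
      ≤ T₁ * ((D / Wmin + Cχ * lam) * (2 * ∫ X in (Xl - T₁ - 1)..(Xr + T₁ + 1), e (0, X))
        + Cχ / (lam * Wmin) * (2 * (∫ X in (Xl - T₁ - 1)..(Xr + T₁ + 1), e₁ (0, X))
          + 16 * T₁ ^ 2 * D ^ 2 * (∫ X in (Xl - T₁ - 1)..(Xr + T₁ + 1), e (0, X)) / Wmin)) := by
  have hu2 : ContDiff ℝ 2 u := hu.of_le (by norm_num)
  set v : ℝ × ℝ → ℝ := fun w => fderiv ℝ u w (0, 1) with hvdef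
  have hv2 : ContDiff ℝ 2 v := contDiff_two_fderiv_apply hu (0, 1)
  set A : ℝ := Xl - T₁ - 1 with hA
  set B : ℝ := Xr + T₁ + 1 with hB
  have hAB : A ≤ B := by rw [hA, hB]; linarith
  have hCχ : 0 ≤ Cχ := (abs_nonneg _).trans (hχ' 0)
  set m : ℝ × ℝ → ℝ := fun z => 2 * fderiv ℝ u z (1, 0) * fderiv ℝ u z (0, 1) with hmdef
  have hm : ∀ z, m z = 2 * fderiv ℝ u z (1, 0) * fderiv ℝ u z (0, 1) := fun z => rfl
  set F : ℝ × ℝ → ℝ := fun z => fderiv ℝ (fderiv ℝ u) z (1, 0) (1, 0)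
      - fderiv ℝ (fderiv ℝ u) z (0, 1) (0, 1) + W z * u z with hFdef
  have hF : ∀ z, F z = fderiv ℝ (fderiv ℝ u) z (1, 0) (1, 0)
      - fderiv ℝ (fderiv ℝ u) z (0, 1) (0, 1) + W z * u z := fun z => rfl
  have he₁' : ∀ z, e₁ z = (fderiv ℝ v z (1, 0)) ^ 2 + (fderiv ℝ v z (0, 1)) ^ 2 + W z * v z ^ 2 :=
    fun z => he₁ z
  have hec : Continuous e := (differentiable_energyDensity hu2 (hW.differentiable (by norm_num)) he).continuous
  have he₁c : Continuous e₁ := (differentiable_energyDensity hv2 (hW.differentiable (by norm_num)) he₁').continuous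
  have he0 : ∀ z, 0 ≤ e z := energyDensity_nonneg hW0 he
  have he₁0 : ∀ z, 0 ≤ e₁ z := energyDensity_nonneg hW0 he₁'
  set E : ℝ → ℝ := fun T => ∫ X in A..B, e (T, X) with hE
  set E₁ : ℝ → ℝ := fun T => ∫ X in A..B, e₁ (T, X) with hE₁
  have hEc : Continuous E :=
    intervalIntegral.continuous_parametric_intervalIntegral_of_continuous' (f := fun T X => e (T, X))
      (show Continuous fun p : ℝ × ℝ => e (p.1, p.2) from hec.comp (continuous_fst.prodMk continuous_snd)) A B
  have hE₁c : Continuous E₁ :=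
    intervalIntegral.continuous_parametric_intervalIntegral_of_continuous' (f := fun T X => e₁ (T, X))
      (show Continuous fun p : ℝ × ℝ => e₁ (p.1, p.2) from he₁c.comp (continuous_fst.prodMk continuous_snd)) A B
  -- the two energy bounds
  have hEb : ∀ t ∈ Icc 0 T₁, E t ≤ 2 * E 0 :=
    energy_le_two_mul hu hW hW0 hsol hzeroL hzeroR hX hT₁ hWmin hD hWK hDK (by linarith) he
  have hE₁b : ∀ t ∈ Icc 0 T₁, E₁ t ≤ 2 * E₁ 0 + 16 * T₁ ^ 2 * D ^ 2 * E 0 / Wmin :=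
    commutedEnergy_le hu hW hW0 hsol hzeroL hzeroR hX hT₁ hWmin hD hWK hDK hDXK hsmall he he₁
  -- `F(0) = 0`
  have hF0 : (∫ X in A..B, χ X * e (0, X)) = 0 := by
    refine (intervalIntegral.integral_congr (g := fun _ => (0 : ℝ)) fun X _ => ?_).trans (by simp)
    by_cases hXl : X < Xl
    · have hz : ((0 : ℝ), X).2 + |((0 : ℝ), X).1| < Xl := by simpa using hXl
      obtain ⟨h1, h2, -⟩ := vanish_left (z := ((0 : ℝ), X)) hzeroL hz
      simp only [he, h1, h2]
      simp
    · push Not at hXl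
      simp only [hχ0 X (by linarith), zero_mul]
  -- boundary terms vanish
  have hbdA : ∀ t ∈ Icc 0 T₁, m (t, A) = 0 := by
    intro t ht
    have hz : (t, A).2 + |(t, A).1| < Xl := by
      simp only; rw [abs_of_nonneg ht.1, hA]; linarith [ht.2]
    obtain ⟨-, h1, -⟩ := vanish_left hzeroL hz
    simp [hm, h1]
  have hbdB : ∀ t ∈ Icc 0 T₁, m (t, B) = 0 := by
    intro t ht
    have hz : Xr < (t, B).2 - |(t, B).1| := by
      simp only; rw [abs_of_nonneg ht.1, hB]; linarith [ht.2]
    obtain ⟨-, h1, -⟩ := vanish_right hzeroR hz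
    simp [hm, h1]
  -- pointwise source bound
  have hsrc : ∀ t ∈ Icc 0 T₁, ∀ X, χ X * (2 * fderiv ℝ u (t, X) (1, 0) * F (t, X)
      + fderiv ℝ W (t, X) (1, 0) * u (t, X) ^ 2) - deriv χ X * m (t, X)
      ≤ (D / Wmin + Cχ * lam) * e (t, X) + Cχ / (lam * Wmin) * e₁ (t, X) := by
    intro t ht X
    rw [hF, hsol (t, X), mul_zero, zero_add, hm]
    obtain ⟨hχ0X, hχ1X⟩ := hχ01 X
    have hχ'X := hχ' X
    by_cases hK : Xl - t ≤ X ∧ X ≤ Xr + t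
    · have hW1 := hWK (t, X) ht hK.1 hK.2
      have hD1 := hDK (t, X) ht hK.1 hK.2
      set a := fderiv ℝ u (t, X) (1, 0) with ha
      set b := fderiv ℝ u (t, X) (0, 1) with hb
      have hea : a ^ 2 ≤ e (t, X) := by
        rw [he]; nlinarith [sq_nonneg b, mul_nonneg (hW0 (t, X)) (sq_nonneg (u (t, X)))]
      have hu2' : Wmin * u (t, X) ^ 2 ≤ e (t, X) := by
        rw [he]
        nlinarith [sq_nonneg a, sq_nonneg b, mul_le_mul_of_nonneg_right hW1 (sq_nonneg (u (t, X)))]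
      have hb2 : Wmin * b ^ 2 ≤ e₁ (t, X) := by
        rw [he₁', hb, hvdef]
        nlinarith [sq_nonneg (fderiv ℝ v (t, X) (1, 0)), sq_nonneg (fderiv ℝ v (t, X) (0, 1)),
          mul_le_mul_of_nonneg_right hW1 (sq_nonneg (fderiv ℝ u (t, X) (0, 1)))]
      -- term 1: `χ W_t u² ≤ (D/Wmin) e`
      have h1 : χ X * (fderiv ℝ W (t, X) (1, 0) * u (t, X) ^ 2) ≤ D / Wmin * e (t, X) := by
        have h11 : fderiv ℝ W (t, X) (1, 0) * u (t, X) ^ 2 ≤ D * u (t, X) ^ 2 :=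
          mul_le_mul_of_nonneg_right (le_of_abs_le hD1) (sq_nonneg _)
        have h12 : D * u (t, X) ^ 2 ≤ D / Wmin * e (t, X) := by
          rw [div_mul_eq_mul_div, le_div_iff₀ hWmin]
          nlinarith [mul_le_mul_of_nonneg_left hu2' hD]
        have h13 : χ X * (fderiv ℝ W (t, X) (1, 0) * u (t, X) ^ 2) ≤ χ X * (D / Wmin * e (t, X)) :=
          mul_le_mul_of_nonneg_left (h11.trans h12) hχ0X
        have h14 : χ X * (D / Wmin * e (t, X)) ≤ 1 * (D / Wmin * e (t, X)) :=
          mul_le_mul_of_nonneg_right hχ1X (by have := he0 (t, X); positivity)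
        linarith
      -- term 2: `−χ' m ≤ Cχ (lam a² + b²/lam)`
      have h2 : -(deriv χ X * (2 * a * b)) ≤ Cχ * (lam * a ^ 2 + b ^ 2 / lam) := by
        have hab : |2 * a * b| ≤ lam * a ^ 2 + b ^ 2 / lam := by
          rw [abs_le]
          constructor
          · have h := sq_nonneg (lam * a + b)
            have hl : lam * a ^ 2 + b ^ 2 / lam + 2 * a * b = (lam * a + b) ^ 2 / lam := by
              field_simp; ring
            have : 0 ≤ (lam * a + b) ^ 2 / lam := div_nonneg h hlam.le
            linarith
          · have h := sq_nonneg (lam * a - b)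
            have hl : lam * a ^ 2 + b ^ 2 / lam - 2 * a * b = (lam * a - b) ^ 2 / lam := by
              field_simp; ring
            have : 0 ≤ (lam * a - b) ^ 2 / lam := div_nonneg h hlam.le
            linarith
        have h21 : -(deriv χ X * (2 * a * b)) ≤ |deriv χ X| * |2 * a * b| := by
          rw [← abs_mul]; exact neg_le_abs (deriv χ X * (2 * a * b))
        have h22 : |deriv χ X| * |2 * a * b| ≤ Cχ * (lam * a ^ 2 + b ^ 2 / lam) :=
          mul_le_mul hχ'X hab (abs_nonneg _) hCχ
        linarith
      have h3 : Cχ * (lam * a ^ 2 + b ^ 2 / lam) ≤ Cχ * lam * e (t, X) + Cχ / (lam * Wmin) * e₁ (t, X) := by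
        have h31 : lam * a ^ 2 ≤ lam * e (t, X) := mul_le_mul_of_nonneg_left hea hlam.le
        have h32 : b ^ 2 / lam ≤ e₁ (t, X) / (lam * Wmin) := by
          rw [div_le_div_iff₀ hlam (by positivity)]
          nlinarith [mul_le_mul_of_nonneg_left hb2 hlam.le]
        have h33 : Cχ * (lam * a ^ 2 + b ^ 2 / lam) ≤ Cχ * (lam * e (t, X) + e₁ (t, X) / (lam * Wmin)) :=
          mul_le_mul_of_nonneg_left (add_le_add h31 h32) hCχ
        have h34 : Cχ * (lam * e (t, X) + e₁ (t, X) / (lam * Wmin))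
            = Cχ * lam * e (t, X) + Cχ / (lam * Wmin) * e₁ (t, X) := by ring
        linarith
      calc χ X * (fderiv ℝ W (t, X) (1, 0) * u (t, X) ^ 2) - deriv χ X * (2 * a * b)
          ≤ D / Wmin * e (t, X) + Cχ * (lam * a ^ 2 + b ^ 2 / lam) := by linarith
        _ ≤ D / Wmin * e (t, X) + (Cχ * lam * e (t, X) + Cχ / (lam * Wmin) * e₁ (t, X)) := by linarith
        _ = (D / Wmin + Cχ * lam) * e (t, X) + Cχ / (lam * Wmin) * e₁ (t, X) := by ring
    · have hzz : u (t, X) = 0 ∧ fderiv ℝ u (t, X) = 0 := by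
        rcases not_and_or.mp hK with h | h
        · push Not at h
          obtain ⟨h1, h2, -⟩ := vanish_left hzeroL (show (t, X).2 + |(t, X).1| < Xl by
            simp only; rw [abs_of_nonneg ht.1]; linarith)
          exact ⟨h1, h2⟩
        · push Not at h
          obtain ⟨h1, h2, -⟩ := vanish_right hzeroR (show Xr < (t, X).2 - |(t, X).1| by
            simp only; rw [abs_of_nonneg ht.1]; linarith)
          exact ⟨h1, h2⟩
      rw [hzz.1, hzz.2]
      have : 0 ≤ (D / Wmin + Cχ * lam) * e (t, X) + Cχ / (lam * Wmin) * e₁ (t, X) := by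
        have := he₁0 (t, X); have := he0 (t, X); positivity
      simpa using this
  -- the weighted identity on `[A, B] × [0, T₁]`
  have key := weightedEnergy_identity_affine hu2 hW hχ he hm hF A 0 B 0 0 T₁
  simp only [zero_mul, add_zero, mul_zero] at key
  have hbd : (∫ t in (0 : ℝ)..T₁, (χ B * m (t, B) - χ A * m (t, A))) = 0 := by
    refine (intervalIntegral.integral_congr (g := fun _ => (0 : ℝ)) fun t ht => ?_).trans (by simp)
    rw [uIcc_of_le hT₁.le] at ht
    simp [hbdA t ht, hbdB t ht]
  rw [hbd, zero_add, hF0, sub_zero] at key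
  -- continuity of the source integrand
  have hsc : Continuous fun p : ℝ × ℝ => χ p.2 * (2 * fderiv ℝ u p (1, 0) * F p
      + fderiv ℝ W p (1, 0) * u p ^ 2) - deriv χ p.2 * m p := by
    have h1 := continuous_fderiv_apply hu2 (1, 0)
    have h1' := continuous_fderiv_apply hu2 (0, 1)
    have h2 := continuous_defect hu2 hW.continuous hF
    have h3 : Continuous fun p : ℝ × ℝ => fderiv ℝ W p (1, 0) :=
      (hW.continuous_fderiv (by norm_num)).clm_apply continuous_const
    have hχc : Continuous fun p : ℝ × ℝ => χ p.2 := hχ.continuous.comp continuous_snd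
    have hχ'c : Continuous fun p : ℝ × ℝ => deriv χ p.2 := (hχ.continuous_deriv (by norm_num)).comp continuous_snd
    have hmc : Continuous m := by rw [hmdef]; exact (continuous_const.mul h1).mul h1'
    exact (hχc.mul (((continuous_const.mul h1).mul h2).add (h3.mul (hu2.continuous.pow 2)))).sub (hχ'c.mul hmc)
  have hsrc_int : (∫ t in (0 : ℝ)..T₁, ∫ X in A..B,
      (χ X * (2 * fderiv ℝ u (t, X) (1, 0) * F (t, X) + fderiv ℝ W (t, X) (1, 0) * u (t, X) ^ 2)
        - deriv χ X * m (t, X)))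
      ≤ ∫ t in (0 : ℝ)..T₁, ((D / Wmin + Cχ * lam) * E t + Cχ / (lam * Wmin) * E₁ t) := by
    refine intervalIntegral.integral_mono_on hT₁.le ?_ ?_ fun t ht => ?_
    · exact (intervalIntegral.continuous_parametric_intervalIntegral_of_continuous'
        (f := fun t X => χ X * (2 * fderiv ℝ u (t, X) (1, 0) * F (t, X)
          + fderiv ℝ W (t, X) (1, 0) * u (t, X) ^ 2) - deriv χ X * m (t, X))
        (show Continuous fun p : ℝ × ℝ => χ p.2 * (2 * fderiv ℝ u (p.1, p.2) (1, 0) * F (p.1, p.2)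
            + fderiv ℝ W (p.1, p.2) (1, 0) * u (p.1, p.2) ^ 2) - deriv χ p.2 * m (p.1, p.2) from
          hsc.comp (continuous_fst.prodMk continuous_snd)) A B).intervalIntegrable _ _
    · exact ((continuous_const.mul hEc).add (continuous_const.mul hE₁c)).intervalIntegrable _ _
    · rw [hE₁, hE]
      simp only
      rw [← intervalIntegral.integral_const_mul, ← intervalIntegral.integral_const_mul,
        ← intervalIntegral.integral_add]
      · refine intervalIntegral.integral_mono_on hAB ?_ ?_ fun X _ => hsrc t ht X
        · exact (hsc.comp (Continuous.prodMk_right t)).intervalIntegrable _ _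
        · exact ((continuous_const.mul (hec.comp (Continuous.prodMk_right t))).add
            (continuous_const.mul (he₁c.comp (Continuous.prodMk_right t)))).intervalIntegrable _ _
      · exact (continuous_const.mul (hec.comp (Continuous.prodMk_right t))).intervalIntegrable _ _
      · exact (continuous_const.mul (he₁c.comp (Continuous.prodMk_right t))).intervalIntegrable _ _
  have hsplit : ∫ t in (0 : ℝ)..T₁, ((D / Wmin + Cχ * lam) * E t + Cχ / (lam * Wmin) * E₁ t)
      = (D / Wmin + Cχ * lam) * (∫ t in (0 : ℝ)..T₁, E t) + Cχ / (lam * Wmin) * ∫ t in (0 : ℝ)..T₁, E₁ t := by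
    have i1 : IntervalIntegrable (fun t => (D / Wmin + Cχ * lam) * E t) volume 0 T₁ := by
      exact (continuous_const.mul hEc).intervalIntegrable _ _
    have i2 : IntervalIntegrable (fun t => Cχ / (lam * Wmin) * E₁ t) volume 0 T₁ := by
      exact (continuous_const.mul hE₁c).intervalIntegrable _ _
    rw [intervalIntegral.integral_add i1 i2,
      intervalIntegral.integral_const_mul, intervalIntegral.integral_const_mul]
  have hE00 : 0 ≤ E 0 := intervalIntegral.integral_nonneg hAB fun X _ => he0 _
  have hEint : ∫ t in (0 : ℝ)..T₁, E t ≤ T₁ * (2 * E 0) := by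
    have h1 : ∫ t in (0 : ℝ)..T₁, E t ≤ ∫ t in (0 : ℝ)..T₁, 2 * E 0 :=
      intervalIntegral.integral_mono_on hT₁.le (hEc.intervalIntegrable _ _) _root_.intervalIntegrable_const
        fun t ht => hEb t ht
    rw [intervalIntegral.integral_const, smul_eq_mul, sub_zero] at h1
    linarith
  have hE₁int : ∫ t in (0 : ℝ)..T₁, E₁ t ≤ T₁ * (2 * E₁ 0 + 16 * T₁ ^ 2 * D ^ 2 * E 0 / Wmin) := by
    have h1 : ∫ t in (0 : ℝ)..T₁, E₁ t ≤ ∫ t in (0 : ℝ)..T₁, (2 * E₁ 0 + 16 * T₁ ^ 2 * D ^ 2 * E 0 / Wmin) :=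
      intervalIntegral.integral_mono_on hT₁.le (hE₁c.intervalIntegrable _ _) _root_.intervalIntegrable_const
        fun t ht => hE₁b t ht
    rw [intervalIntegral.integral_const, smul_eq_mul, sub_zero] at h1
    linarith
  have hc1 : 0 ≤ D / Wmin + Cχ * lam := by positivity
  have hc2 : 0 ≤ Cχ / (lam * Wmin) := by positivity
  have hfinal : (∫ X in A..B, χ X * e (T₁, X))
      ≤ (D / Wmin + Cχ * lam) * (T₁ * (2 * E 0))
        + Cχ / (lam * Wmin) * (T₁ * (2 * E₁ 0 + 16 * T₁ ^ 2 * D ^ 2 * E 0 / Wmin)) := by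
    have h1 := mul_le_mul_of_nonneg_left hEint hc1
    have h2 := mul_le_mul_of_nonneg_left hE₁int hc2
    linarith [key.le, hsrc_int, hsplit]
  have hE0def : E 0 = ∫ X in A..B, e (0, X) := rfl
  have hE₁0def : E₁ 0 = ∫ X in A..B, e₁ (0, X) := rfl
  rw [hE0def, hE₁0def] at hfinal
  linarith [hfinal]

end WaveDefect

end

end Summit.FinalStateConjecture.FinalStateConjecture.Theorems
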